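import Summits.BirchSwinnertonDyer.BirchSwinnertonDyer.Theorems.BiquadraticEisensteinDescentHeegnerTwistCouplingInSupplyQuarticPartnerCorner
import HarnessLib

set_option linter.dupNamespace false -- `Summit.BirchSwinnertonDyer.BirchSwinnertonDyer.Theorems.…` (summit = sub)
set_option autoImplicit false

/-!
# Crux `HeegnerTwistCouplingInSupply` (stmt-BirchSwinnertonDyer-21381) — the QUARTIC `j = 1728` corner, partner LADDER:
# rungs `r = 53`, `r = 61` and the union over the partners `{5, 13, 29, 37, 53, 61}`

Route `BiquadraticEisensteinDescent` (cell `pub/bsd-wall`, width seat `bsd-wall-cm-bed-w4` g13; `--supports` 21381, helper). Instances of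
the generic rung `…QuarticPartnerCorner.cruxOnQuarticCornerPartner_of_two_facts` for the partners `53` (threshold `P = 629`) and `61`
(`P = 795`), and ★★ `cruxOnQuarticCornerLadder_of_two_facts`: for every prime `p ≡ 7 (mod 8)`, `p ≥ 795`, lying in a sharp class for at
least one partner `r ∈ {5, 13, 29, 37, 53, 61}` (`p` a square but not a fourth power mod `r`; for `r = 5`: `p ≡ 4 (mod 5)`, all `p`, from
`…QuarticTwistCorner`), the CONCLUSION of crux 21381 holds for `W_p⁻ : y² = x³ − px` modulo Burungale–Tian + Deuring–Hecke ONLY.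
Asymptotic coverage of the habitat `p ≡ 7 (mod 8)`: `1 − (3/4)⁶ ≈ 82 %` (CRT + Dirichlet; each further partner `r ≡ 5 (mod 8)` is a one-liner
and multiplies the uncovered set by `3/4`; never all `p`).

HONEST FRAMING: typed sub-corner rungs on one CM family (measure zero in «all CM `W`»); the crux (residual C⁺) is untouched; 21381 is NOT
closed by corner theorems; BSD is not proved by any of this. THEOREMS ONLY. Supports stmt-BirchSwinnertonDyer-21381.
-/

noncomputable section

open scoped Classical NumberField

namespace Summit.BirchSwinnertonDyer.BirchSwinnertonDyer.Theorems.BiquadraticEisensteinDescentHeegnerTwistCouplingInSupplyQuarticPartnerLadder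

open _root_.WeierstrassCurve Literature.NumberTheory.EllipticCurves
open Summit.BirchSwinnertonDyer.BirchSwinnertonDyer.Theorems.BiquadraticEisensteinDescentHeegnerTwistCouplingInSupplyQuarticTwistCorner
open Summit.BirchSwinnertonDyer.BirchSwinnertonDyer.Theorems.BiquadraticEisensteinDescentHeegnerTwistCouplingInSupplyQuarticPartnerCorner

/-! ## §1 Rungs `53` and `61` -/

set_option maxRecDepth 8192 in
/-- The squares that are not fourth powers modulo `53`: `4, 6, 7, 9, 11, 17, 25, 29, 37, 38, 40, 43, 52`. [folklore] -/
theorem classes_fiftyThree : ∀ a : ZMod 53, (a = 4 ∨ a = 6 ∨ a = 7 ∨ a = 9 ∨ a = 11 ∨ a = 17 ∨ a = 25 ∨ a = 29 ∨ a = 37 ∨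
    a = 38 ∨ a = 40 ∨ a = 43 ∨ a = 52) →
    IsSquare a ∧ ∀ t : ZMod 53, t ^ 4 ≠ a := by decide

/-- ★ **Rung `r = 53`**: every prime `p ≡ 7 (mod 8)`, `p ≥ 629`, with `p mod 53` a square but not a fourth power — the crux conclusion for
`W_p⁻`, modulo Burungale–Tian + Deuring–Hecke. [cite: BurungaleTian2026, Thm. 1.1] [cite: Oesterle1988Gauss, II §3 Proposition p. 57 (27)] -/
theorem cruxOnQuarticCornerFiftyThree_of_two_facts (hBT : burungaleTian_analyticRank_eq_zero_of_selmerCorank_eq_zero_of_hasCM)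
    (hH : hasEntireLFunction_of_j_mem_maximalCMJInvariants) :
    ∀ (p : ℕ) [Fact p.Prime] [(⟨0, 0, 0, -(p : ℚ), 0⟩ : WeierstrassCurve ℚ).IsElliptic]
      [(⟨0, 0, 0, -(p : ℚ), 0⟩ : WeierstrassCurve ℚ).IsGloballyMinimal]
      [NeZero ((⟨0, 0, 0, -(p : ℚ), 0⟩ : WeierstrassCurve ℚ).conductorNorm ℤ)],
      p % 8 = 7 → 629 ≤ p → (p % 53 = 4 ∨ p % 53 = 6 ∨ p % 53 = 7 ∨ p % 53 = 9 ∨ p % 53 = 11 ∨ p % 53 = 17 ∨ p % 53 = 25 ∨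
          p % 53 = 29 ∨ p % 53 = 37 ∨ p % 53 = 38 ∨ p % 53 = 40 ∨ p % 53 = 43 ∨ p % 53 = 52) →
      ∃ (K : Type) (_ : Field K) (_ : NumberField K),
        IsImaginaryQuadratic K ∧ 4 < (NumberField.discr K).natAbs ∧
        SatisfiesHeegnerHypothesis ((⟨0, 0, 0, -(p : ℚ), 0⟩ : WeierstrassCurve ℚ).conductorNorm ℤ) K ∧
        ((⟨0, 0, 0, -(p : ℚ), 0⟩ : WeierstrassCurve ℚ).quadraticTwist (NumberField.discr K : ℚ)).entireLFunction 1 ≠ 0 ∧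
        NumberField.classNumber K < p ∧ ¬ p ∣ NumberField.classNumber K := by
  intro p _ _ _ _ hp8 hP hres
  have hcast : ((p : ℤ) : ZMod 53) = ((p % 53 : ℕ) : ZMod 53) := intCast_natCast_zmod_eq_mod p 53
  have hcl : ((p : ℤ) : ZMod 53) = 4 ∨ ((p : ℤ) : ZMod 53) = 6 ∨ ((p : ℤ) : ZMod 53) = 7 ∨ ((p : ℤ) : ZMod 53) = 9 ∨
      ((p : ℤ) : ZMod 53) = 11 ∨ ((p : ℤ) : ZMod 53) = 17 ∨ ((p : ℤ) : ZMod 53) = 25 ∨ ((p : ℤ) : ZMod 53) = 29 ∨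
      ((p : ℤ) : ZMod 53) = 37 ∨ ((p : ℤ) : ZMod 53) = 38 ∨ ((p : ℤ) : ZMod 53) = 40 ∨ ((p : ℤ) : ZMod 53) = 43 ∨
      ((p : ℤ) : ZMod 53) = 52 := by
    rw [hcast]
    rcases hres with h | h | h | h | h | h | h | h | h | h | h | h | h <;> rw [h] <;> simp
  obtain ⟨hsq, hp4⟩ := classes_fiftyThree _ hcl
  exact cruxOnQuarticCornerPartner_of_two_facts hBT hH (by norm_num) (by norm_num) (P := 629) (by norm_num) p hp8 hP hsq hp4

set_option maxRecDepth 8192 in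
/-- The squares that are not fourth powers modulo `61`: `3, 4, 5, 14, 19, 27, 36, 39, 41, 45, 46, 48, 49, 52, 60`. [folklore] -/
theorem classes_sixtyOne : ∀ a : ZMod 61, (a = 3 ∨ a = 4 ∨ a = 5 ∨ a = 14 ∨ a = 19 ∨ a = 27 ∨ a = 36 ∨ a = 39 ∨ a = 41 ∨
    a = 45 ∨ a = 46 ∨ a = 48 ∨ a = 49 ∨ a = 52 ∨ a = 60) →
    IsSquare a ∧ ∀ t : ZMod 61, t ^ 4 ≠ a := by decide

/-- ★ **Rung `r = 61`**: every prime `p ≡ 7 (mod 8)`, `p ≥ 795`, with `p mod 61` a square but not a fourth power — the crux conclusion for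
`W_p⁻`, modulo Burungale–Tian + Deuring–Hecke. [cite: BurungaleTian2026, Thm. 1.1] [cite: Oesterle1988Gauss, II §3 Proposition p. 57 (27)] -/
theorem cruxOnQuarticCornerSixtyOne_of_two_facts (hBT : burungaleTian_analyticRank_eq_zero_of_selmerCorank_eq_zero_of_hasCM)
    (hH : hasEntireLFunction_of_j_mem_maximalCMJInvariants) :
    ∀ (p : ℕ) [Fact p.Prime] [(⟨0, 0, 0, -(p : ℚ), 0⟩ : WeierstrassCurve ℚ).IsElliptic]
      [(⟨0, 0, 0, -(p : ℚ), 0⟩ : WeierstrassCurve ℚ).IsGloballyMinimal]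
      [NeZero ((⟨0, 0, 0, -(p : ℚ), 0⟩ : WeierstrassCurve ℚ).conductorNorm ℤ)],
      p % 8 = 7 → 795 ≤ p → (p % 61 = 3 ∨ p % 61 = 4 ∨ p % 61 = 5 ∨ p % 61 = 14 ∨ p % 61 = 19 ∨ p % 61 = 27 ∨ p % 61 = 36 ∨
          p % 61 = 39 ∨ p % 61 = 41 ∨ p % 61 = 45 ∨ p % 61 = 46 ∨ p % 61 = 48 ∨ p % 61 = 49 ∨ p % 61 = 52 ∨ p % 61 = 60) →
      ∃ (K : Type) (_ : Field K) (_ : NumberField K),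
        IsImaginaryQuadratic K ∧ 4 < (NumberField.discr K).natAbs ∧
        SatisfiesHeegnerHypothesis ((⟨0, 0, 0, -(p : ℚ), 0⟩ : WeierstrassCurve ℚ).conductorNorm ℤ) K ∧
        ((⟨0, 0, 0, -(p : ℚ), 0⟩ : WeierstrassCurve ℚ).quadraticTwist (NumberField.discr K : ℚ)).entireLFunction 1 ≠ 0 ∧
        NumberField.classNumber K < p ∧ ¬ p ∣ NumberField.classNumber K := by
  intro p _ _ _ _ hp8 hP hres
  have hcast : ((p : ℤ) : ZMod 61) = ((p % 61 : ℕ) : ZMod 61) := intCast_natCast_zmod_eq_mod p 61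
  have hcl : ((p : ℤ) : ZMod 61) = 3 ∨ ((p : ℤ) : ZMod 61) = 4 ∨ ((p : ℤ) : ZMod 61) = 5 ∨ ((p : ℤ) : ZMod 61) = 14 ∨
      ((p : ℤ) : ZMod 61) = 19 ∨ ((p : ℤ) : ZMod 61) = 27 ∨ ((p : ℤ) : ZMod 61) = 36 ∨ ((p : ℤ) : ZMod 61) = 39 ∨
      ((p : ℤ) : ZMod 61) = 41 ∨ ((p : ℤ) : ZMod 61) = 45 ∨ ((p : ℤ) : ZMod 61) = 46 ∨ ((p : ℤ) : ZMod 61) = 48 ∨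
      ((p : ℤ) : ZMod 61) = 49 ∨ ((p : ℤ) : ZMod 61) = 52 ∨ ((p : ℤ) : ZMod 61) = 60 := by
    rw [hcast]
    rcases hres with h | h | h | h | h | h | h | h | h | h | h | h | h | h | h <;> rw [h] <;> simp
  obtain ⟨hsq, hp4⟩ := classes_sixtyOne _ hcl
  exact cruxOnQuarticCornerPartner_of_two_facts hBT hH (by norm_num) (by norm_num) (P := 795) (by norm_num) p hp8 hP hsq hp4

/-! ## §2 ★★ The union ladder -/

/-- ★★ **THE QUARTIC PARTNER LADDER, six partners**: for every prime `p ≡ 7 (mod 8)`, `p ≥ 795`, in a sharp class modulo one of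
`5, 13, 29, 37, 53, 61`, the CONCLUSION of crux 21381 holds for `W_p⁻ : y² = x³ − p·x` — modulo Burungale–Tian + Deuring–Hecke ONLY.
[cite: BurungaleTian2026, Thm. 1.1] [cite: SilvermanAEC2009, Prop. X.4.9, Prop. X.4.7, Thm. X.4.2(a)] [cite: Oesterle1988Gauss, II §3 Proposition p. 57 (27)] -/
theorem cruxOnQuarticCornerLadder_of_two_facts (hBT : burungaleTian_analyticRank_eq_zero_of_selmerCorank_eq_zero_of_hasCM)
    (hH : hasEntireLFunction_of_j_mem_maximalCMJInvariants) :
    ∀ (p : ℕ) [Fact p.Prime] [(⟨0, 0, 0, -(p : ℚ), 0⟩ : WeierstrassCurve ℚ).IsElliptic]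
      [(⟨0, 0, 0, -(p : ℚ), 0⟩ : WeierstrassCurve ℚ).IsGloballyMinimal]
      [NeZero ((⟨0, 0, 0, -(p : ℚ), 0⟩ : WeierstrassCurve ℚ).conductorNorm ℤ)],
      p % 8 = 7 → 795 ≤ p →
      (p % 5 = 4 ∨ (p % 13 = 4 ∨ p % 13 = 10 ∨ p % 13 = 12) ∨ (p % 29 = 4 ∨ p % 29 = 5 ∨ p % 29 = 6 ∨ p % 29 = 9 ∨
          p % 29 = 13 ∨ p % 29 = 22 ∨ p % 29 = 28) ∨
        (p % 37 = 3 ∨ p % 37 = 4 ∨ p % 37 = 11 ∨ p % 37 = 21 ∨ p % 37 = 25 ∨ p % 37 = 27 ∨ p % 37 = 28 ∨ p % 37 = 30 ∨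
            p % 37 = 36) ∨
        (p % 53 = 4 ∨ p % 53 = 6 ∨ p % 53 = 7 ∨ p % 53 = 9 ∨ p % 53 = 11 ∨ p % 53 = 17 ∨ p % 53 = 25 ∨ p % 53 = 29 ∨
            p % 53 = 37 ∨ p % 53 = 38 ∨ p % 53 = 40 ∨ p % 53 = 43 ∨ p % 53 = 52) ∨
        (p % 61 = 3 ∨ p % 61 = 4 ∨ p % 61 = 5 ∨ p % 61 = 14 ∨ p % 61 = 19 ∨ p % 61 = 27 ∨ p % 61 = 36 ∨ p % 61 = 39 ∨
            p % 61 = 41 ∨ p % 61 = 45 ∨ p % 61 = 46 ∨ p % 61 = 48 ∨ p % 61 = 49 ∨ p % 61 = 52 ∨ p % 61 = 60)) →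
      ∃ (K : Type) (_ : Field K) (_ : NumberField K),
        IsImaginaryQuadratic K ∧ 4 < (NumberField.discr K).natAbs ∧
        SatisfiesHeegnerHypothesis ((⟨0, 0, 0, -(p : ℚ), 0⟩ : WeierstrassCurve ℚ).conductorNorm ℤ) K ∧
        ((⟨0, 0, 0, -(p : ℚ), 0⟩ : WeierstrassCurve ℚ).quadraticTwist (NumberField.discr K : ℚ)).entireLFunction 1 ≠ 0 ∧
        NumberField.classNumber K < p ∧ ¬ p ∣ NumberField.classNumber K := by
  intro p _ _ _ _ hp8 hP h
  rcases h with h5 | h13 | h29 | h37 | h53 | h61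
  · exact cruxOnQuarticCorner_of_two_facts hBT hH p hp8 h5
  · exact cruxOnQuarticCornerThirteen_of_two_facts hBT hH p hp8 (by omega) h13
  · exact cruxOnQuarticCornerTwentyNine_of_two_facts hBT hH p hp8 (by omega) h29
  · exact cruxOnQuarticCornerThirtySeven_of_two_facts hBT hH p hp8 (by omega) h37
  · exact cruxOnQuarticCornerFiftyThree_of_two_facts hBT hH p hp8 (by omega) h53
  · exact cruxOnQuarticCornerSixtyOne_of_two_facts hBT hH p hp8 hP h61

end Summit.BirchSwinnertonDyer.BirchSwinnertonDyer.Theorems.BiquadraticEisensteinDescentHeegnerTwistCouplingInSupplyQuarticPartnerLadder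

end
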